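import Mathlib
import HarnessLib

/-!
# Stub `stub_monotoneWindow` (P2) of line `Sketch`, crux stmt-AtomisticToContinuum-13416

This file is stub P2 of line `Sketch` (idea `zero-mean-dyadic-splice`) of the crux
`Summit.AtomisticToContinuum.FouriersLaw.Theses.StaticAbelianSqueeze.UniformAbelianRegularity`
(item stmt-AtomisticToContinuum-13416). It closes nothing by itself: it is the pure real-analysis
Bonnet-type (second mean value) bound consumed by the composition `UniformAbelianRegularity_of`
of the skeleton `Lines/Sketch.lean`.

Statement: if `c ∈ L¹(a, ∞)`, `L` is monotone and continuous with `L a = 0` and `L ≤ 1`, and the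
signed tails obey `|∫_{(ξ,∞)} c| ≤ B` for all `ξ ≥ a`, then `|∫_{(a,∞)} L c| ≤ B`.

Proof: replace `L` by the clipped weight `M t = L (max t a)` (same integrand on `(a, ∞)`,
`0 ≤ M ≤ 1`, `M = 0` on `(-∞, a]`), let `ρ` be the Stieltjes measure of `M` (total mass `≤ 1`,
`ρ (Iic t) = M t`), write `M t * c t = ∫ 1_{s ≤ t} c t dρ(s)`, swap the two integrals (Fubini on
`volume|_(a,∞) × ρ`), and bound each inner integral `∫_{(a,∞) ∩ [s,∞)} c = ∫_{(max s a, ∞)} c`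
by `B`; the outer integral of the constant `B` against `ρ` is `B · ρ(ℝ) ≤ B`.
-/

noncomputable section

namespace Summit.AtomisticToContinuum.FouriersLaw.Theorems.UniformAbelianRegularity.ZeroMeanDyadicSplice

open MeasureTheory Set Filter Topology

/-- **Stub `stub_monotoneWindow` (P2 of line `Sketch`; Bonnet's bound for a monotone late window).**
If `c ∈ L¹(a, ∞)`, `L` is monotone and continuous with `L a = 0` and `L ≤ 1`, and the signed tails
satisfy `|∫_{(ξ,∞)} c| ≤ B` for all `ξ ≥ a`, then `|∫_{(a,∞)} L c| ≤ B`. Proof: Fubini against the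
Stieltjes measure of the clipped weight `t ↦ L (max t a)` (total mass `≤ 1`):
`∫_{(a,∞)} L c = ∫ (∫_{(max s a,∞)} c) dL(s)`. [folklore] -/
theorem stub_monotoneWindow :
    ∀ (c L : ℝ → ℝ) (a B : ℝ), MeasureTheory.IntegrableOn c (Set.Ioi a) → Monotone L → Continuous L → L a = 0 →
      (∀ t : ℝ, L t ≤ 1) → (∀ ξ : ℝ, a ≤ ξ → |∫ t in Set.Ioi ξ, c t| ≤ B) → |∫ t in Set.Ioi a, L t * c t| ≤ B := by
  intro c L a B hc hLmono hLcont hLa hL1 htail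
  -- (0) `0 ≤ B`, from the tail hypothesis at `ξ = a`.
  have hB : 0 ≤ B := (abs_nonneg _).trans (htail a le_rfl)
  -- (1) The clipped weight `M t = L (max t a)`: monotone, continuous, `0 ≤ M ≤ 1`, `M = 0` left of `a`.
  obtain ⟨M, hM⟩ : ∃ M : ℝ → ℝ, ∀ t, M t = L (max t a) := ⟨fun t => L (max t a), fun _ => rfl⟩
  have hMmono : Monotone M := fun x y hxy => by
    rw [hM, hM]; exact hLmono (max_le_max hxy le_rfl)
  have hMcont : Continuous M := by
    have : M = fun t => L (max t a) := funext hM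
    rw [this]; exact hLcont.comp (continuous_id.max continuous_const)
  have hM_nonneg : ∀ t, 0 ≤ M t := fun t => by
    rw [hM, ← hLa]; exact hLmono (le_max_right t a)
  have hM_le : ∀ t, M t ≤ 1 := fun t => by rw [hM]; exact hL1 _
  have hM_of_le : ∀ t, t ≤ a → M t = 0 := fun t ht => by rw [hM, max_eq_right ht, hLa]
  have hM_of_ge : ∀ t, a ≤ t → M t = L t := fun t ht => by rw [hM, max_eq_left ht]
  -- limits of `M` at `-∞` (namely `0`) and at `+∞` (namely `⨆ M ≤ 1`)
  have hbot : Tendsto M atBot (𝓝 0) := by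
    refine tendsto_const_nhds.congr' ?_
    filter_upwards [eventually_le_atBot a] with t ht
    exact (hM_of_le t ht).symm
  have hbdd : BddAbove (range M) := ⟨1, by rintro _ ⟨t, rfl⟩; exact hM_le t⟩
  have htop : Tendsto M atTop (𝓝 (⨆ t, M t)) := tendsto_atTop_ciSup hMmono hbdd
  have hsup_le : (⨆ t, M t) ≤ 1 := ciSup_le hM_le
  -- (2) The Stieltjes measure `ρ = dM`: finite, total mass `≤ 1`, `ρ (Iic t) = M t`.
  -- (`M` is continuous, hence right-continuous, so it bundles as a Stieltjes function `F`.)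
  let F : StieltjesFunction ℝ := ⟨M, hMmono, fun _ => hMcont.continuousWithinAt⟩
  have hF : ⇑F = M := rfl
  have hFbot : Tendsto F atBot (𝓝 0) := by rw [hF]; exact hbot
  have hFtop : Tendsto F atTop (𝓝 (⨆ t, M t)) := by rw [hF]; exact htop
  haveI hfin : IsFiniteMeasure F.measure := F.isFiniteMeasure hFbot hFtop
  have hρ_Iic : ∀ t, F.measure.real (Iic t) = M t := fun t => by
    rw [measureReal_def, F.measure_Iic hFbot t, sub_zero, hF, ENNReal.toReal_ofReal (hM_nonneg t)]
  have hρ_univ : F.measure.real univ ≤ 1 := by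
    rw [measureReal_def, F.measure_univ hFbot hFtop, sub_zero, ENNReal.toReal_ofReal']
    exact max_le hsup_le zero_le_one
  -- (3) The integrand `Φ (t, s) = 1_{s ≤ t} c t` on `volume|_(a,∞) × ρ`.
  obtain ⟨E, hE⟩ : ∃ E : Set (ℝ × ℝ), E = {p | p.2 ≤ p.1} := ⟨_, rfl⟩
  have hEmeas : MeasurableSet E := by
    rw [hE]; exact measurableSet_le measurable_snd measurable_fst
  obtain ⟨Φ, hΦ⟩ : ∃ Φ : ℝ × ℝ → ℝ, Φ = E.indicator fun p => c p.1 := ⟨_, rfl⟩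
  have hΦint : Integrable Φ ((volume.restrict (Ioi a)).prod F.measure) := by
    rw [hΦ]; exact (hc.comp_fst F.measure).indicator hEmeas
  -- sections of `Φ`
  have hsec_t : ∀ t, (fun s => Φ (t, s)) = (Iic t).indicator fun _ => c t := by
    intro t; funext s
    simp [hΦ, hE, Set.indicator_apply]
  have hsec_s : ∀ s, (fun t => Φ (t, s)) = (Ici s).indicator c := by
    intro s; funext t
    simp [hΦ, hE, Set.indicator_apply]
  -- inner integral in `s` for fixed `t > a`: `∫ Φ (t, ·) dρ = ρ (Iic t) c t = L t c t`
  have hinner_t : ∀ t, a < t → ∫ s, Φ (t, s) ∂F.measure = L t * c t := by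
    intro t ht
    rw [hsec_t t, integral_indicator_const _ measurableSet_Iic, hρ_Iic, hM_of_ge t ht.le, smul_eq_mul]
  -- inner integral in `t` for fixed `s`: a signed tail of `c`, bounded by `B`
  have hinner_s : ∀ s, |∫ t in Ioi a, Φ (t, s)| ≤ B := by
    intro s
    rw [hsec_s s, setIntegral_indicator measurableSet_Ici]
    rcases le_or_gt s a with hs | hs
    · rw [Set.inter_eq_left.mpr (Set.Ioi_subset_Ici hs)]
      exact htail a le_rfl
    · rw [Set.inter_eq_right.mpr (Set.Ici_subset_Ioi.mpr hs), integral_Ici_eq_integral_Ioi]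
      exact htail s hs.le
  -- (4) Fubini and the final bound.
  have hswap : ∫ t in Ioi a, (∫ s, Φ (t, s) ∂F.measure) = ∫ s, (∫ t in Ioi a, Φ (t, s)) ∂F.measure :=
    integral_integral_swap (f := fun t s => Φ (t, s)) hΦint
  have hLHS : ∫ t in Ioi a, L t * c t = ∫ t in Ioi a, (∫ s, Φ (t, s) ∂F.measure) :=
    setIntegral_congr_fun measurableSet_Ioi fun t ht => (hinner_t t ht).symm
  have key : ‖∫ s, (∫ t in Ioi a, Φ (t, s)) ∂F.measure‖ ≤ B * F.measure.real univ :=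
    norm_integral_le_of_norm_le_const (Eventually.of_forall fun s => by
      rw [Real.norm_eq_abs]; exact hinner_s s)
  rw [hLHS, hswap, ← Real.norm_eq_abs]
  calc ‖∫ s, (∫ t in Ioi a, Φ (t, s)) ∂F.measure‖ ≤ B * F.measure.real univ := key
    _ ≤ B * 1 := mul_le_mul_of_nonneg_left hρ_univ hB
    _ = B := mul_one B

end Summit.AtomisticToContinuum.FouriersLaw.Theorems.UniformAbelianRegularity.ZeroMeanDyadicSplice

end
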